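import Summits.CriticalPhenomena.CardyFormulaZ2.Theorems.CardyIKTransportIKMixedBoxCrossingDefectStubPivotSolve

/-!
# Stub `stub_evenLawApply` of the line `defect-closure-exploration` (crux `IKMixedBoxCrossing`,
# stmt-CriticalPhenomena-5911): the `t = 0` corner Gibbs measure as the image of the uniform filling law

For a defect set `D ⊆ innerVertices Λ` and a boundary condition `ξ`, the `t = 0` corner Gibbs measure
`cornerGibbsMeasure 0 D Λ ξ` is the uniform measure on the `2 ^ (|Λ| - |D|)` fillings of `Λ` with no odd face
in `D` (RANK LEMMA `cornerPartitionFunction_zero_eq_two_pow`).  The stub says that it is the image of the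
uniform measure on ALL `2 ^ |Λ|` fillings `boxFill Λ ξ s`, `s ⊆ Λ`, under the *pivot completion*
`s ↦ σ_s` = the unique colouring agreeing with `boxFill Λ ξ s` off the pivot set `P = D.image (· + 1)` and
having no odd face in `D` (`stub_pivotSolve`): the mass of `E` is `2 ^ {-|Λ|} · #{s ⊆ Λ | σ_s ∈ E}`.

PROOF (programme (R) helper; elementary, no literature fact).
* `cornerGibbsMeasure 0 D Λ ξ E = Z⁻¹ · N` with `Z = 2 ^ (|Λ| - |D|)` (rank lemma) and
  `N = #{s₀ ⊆ Λ | boxFill Λ ξ s₀ ∈ E and D-even}` (the `t = 0` weights are indicators,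
  `cornerGibbsMeasure_apply`, `cornerWeight_zero_eq_ite`, `Finset.sum_boole`).
* DOUBLE COUNTING (`Finset.card_mul_eq_card_mul`) of the relation "`boxFill Λ ξ s₀` agrees with
  `boxFill Λ ξ s` off `P`" between `M = #{s ⊆ Λ | ∃ σ ∈ E agreeing with boxFill Λ ξ s off P, D-even}` and
  `N`: every `s` counted by `M` is related to exactly one `s₀` counted by `N` (the witness `σ` agrees with
  `ξ` off `Λ ⊇ P`, so it is a `boxFill Λ ξ s₀`; uniqueness by `stub_pivotSolve` and `boxFill_injOn`), and
  every `s₀` counted by `N` is related to exactly the `2 ^ |P| = 2 ^ |D|` sets `s ⊆ Λ` with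
  `s \ P = s₀ \ P`, i.e. the interval `[s₀ \ P, s₀ \ P ∪ P]` of the Boolean lattice
  (`Finset.card_Icc_finset`), all of which are counted by `M` (witness `boxFill Λ ξ s₀`).  Hence
  `M = 2 ^ |D| · N`, and `(2 ^ |Λ|)⁻¹ · 2 ^ |D| = (2 ^ (|Λ| - |D|))⁻¹` in `ℝ≥0∞`.
-/

namespace Summit.CriticalPhenomena.CardyFormulaZ2.Cruxes.IKMixedBoxCrossing.DefectClosureExploration

open scoped BigOperators ENNReal Classical
open MeasureTheory
open Literature.Probability.LatticeModels

namespace EvenLawStub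

/-! ## The pivot set -/

/-- The pivot set `D.image (· + 1)` of a defect set `D ⊆ innerVertices Λ` lies in `Λ` (the NE cell `g + 1`
is a cell of the face `g`). -/
theorem image_add_one_subset {D Λ : Finset (Site 2)} (hD : D ⊆ innerVertices Λ) :
    D.image (· + 1) ⊆ Λ := by
  intro x hx
  obtain ⟨g, hg, rfl⟩ := Finset.mem_image.1 hx
  exact (mem_innerVertices_iff.1 (hD hg)) (mem_cellFace_iff.2 (Or.inr (Or.inr (Or.inr rfl))))

/-- The pivot set has `|D|` elements (`· + 1` is injective). -/
theorem card_image_add_one (D : Finset (Site 2)) : (D.image (· + 1)).card = D.card :=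
  Finset.card_image_of_injective D (add_left_injective (1 : Site 2))

/-- Uniqueness half of `stub_pivotSolve`: two colourings with no odd face in `D` that agree off the pivot
set `D.image (· + 1)` are equal. -/
theorem eq_of_agree_of_even {D : Finset (Site 2)} {σ τ : Site 2 → Bool}
    (h : ∀ x : Site 2, x ∉ D.image (· + 1) → σ x = τ x)
    (hσ : ∀ g ∈ D, ¬ IsOddFace σ g) (hτ : ∀ g ∈ D, ¬ IsOddFace τ g) : σ = τ :=
  (PivotSolveStub.pivotSolve D τ).unique ⟨h, hσ⟩ ⟨fun _ _ => rfl, hτ⟩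

/-! ## The fibres of the restriction off the pivot set -/

/-- For `P, s₀ ⊆ Λ`, the black sets `s ⊆ Λ` whose filling agrees with that of `s₀` off `P` form the
interval `[s₀ \ P, s₀ \ P ∪ P]` of the Boolean lattice. -/
theorem filter_agree_eq_Icc {Λ P s₀ : Finset (Site 2)} (ξ : Site 2 → Bool) (hP : P ⊆ Λ) (hs₀ : s₀ ⊆ Λ) :
    (Λ.powerset.filter fun s => ∀ x : Site 2, x ∉ P → boxFill Λ ξ s₀ x = boxFill Λ ξ s x) =
      Finset.Icc (s₀ \ P) (s₀ \ P ∪ P) := by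
  ext s
  simp only [Finset.mem_filter, Finset.mem_powerset, Finset.mem_Icc]
  constructor
  · rintro ⟨hs, hagree⟩
    -- off `P`, membership in `s₀` and in `s` agree
    have key : ∀ x : Site 2, x ∉ P → (x ∈ s₀ ↔ x ∈ s) := fun x hxP => by
      by_cases hxΛ : x ∈ Λ
      · have h := hagree x hxP
        rw [boxFill_apply_of_mem ξ _ hxΛ, boxFill_apply_of_mem ξ _ hxΛ] at h
        simpa using h
      · exact ⟨fun h => absurd (hs₀ h) hxΛ, fun h => absurd (hs h) hxΛ⟩
    refine ⟨fun x hx => ?_, fun x hx => ?_⟩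
    · rw [Finset.mem_sdiff] at hx
      exact (key x hx.2).1 hx.1
    · rw [Finset.mem_union, Finset.mem_sdiff]
      by_cases hxP : x ∈ P
      · exact Or.inr hxP
      · exact Or.inl ⟨(key x hxP).2 hx, hxP⟩
  · rintro ⟨h1, h2⟩
    refine ⟨h2.trans (Finset.union_subset (Finset.sdiff_subset.trans hs₀) hP), fun x hxP => ?_⟩
    by_cases hxΛ : x ∈ Λ
    · rw [boxFill_apply_of_mem ξ _ hxΛ, boxFill_apply_of_mem ξ _ hxΛ]
      have hiff : x ∈ s₀ ↔ x ∈ s :=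
        ⟨fun hx => h1 (Finset.mem_sdiff.2 ⟨hx, hxP⟩), fun hx => by
          rcases Finset.mem_union.1 (h2 hx) with h | h
          · exact (Finset.mem_sdiff.1 h).1
          · exact absurd h hxP⟩
      simpa using hiff
    · rw [boxFill_apply_of_not_mem ξ _ hxΛ, boxFill_apply_of_not_mem ξ _ hxΛ]

/-- FIBRE COUNT: for `P, s₀ ⊆ Λ`, exactly `2 ^ |P|` black sets `s ⊆ Λ` have a filling agreeing with that of
`s₀` off `P`. -/
theorem card_filter_agree {Λ P s₀ : Finset (Site 2)} (ξ : Site 2 → Bool) (hP : P ⊆ Λ) (hs₀ : s₀ ⊆ Λ) :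
    (Λ.powerset.filter fun s => ∀ x : Site 2, x ∉ P → boxFill Λ ξ s₀ x = boxFill Λ ξ s x).card =
      2 ^ P.card := by
  rw [filter_agree_eq_Icc ξ hP hs₀, Finset.card_Icc_finset Finset.subset_union_left,
    Finset.card_union_of_disjoint Finset.sdiff_disjoint, Nat.add_sub_cancel_left]

/-! ## The counting identity -/

/-- COUNTING IDENTITY (double counting): the number of black sets `s ⊆ Λ` whose pivot completion lies in `E`
is `2 ^ |D|` times the number of `D`-even fillings lying in `E`. -/
theorem card_filter_exists_completion {D Λ : Finset (Site 2)} (hD : D ⊆ innerVertices Λ)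
    (ξ : Site 2 → Bool) (E : Set (Site 2 → Bool)) :
    (Λ.powerset.filter fun s => ∃ σ ∈ E,
        (∀ x : Site 2, x ∉ D.image (· + 1) → σ x = boxFill Λ ξ s x) ∧ ∀ g ∈ D, ¬ IsOddFace σ g).card =
      2 ^ D.card *
        (Λ.powerset.filter fun s =>
          boxFill Λ ξ s ∈ E ∧ ∀ f ∈ D, ¬ IsOddFace (boxFill Λ ξ s) f).card := by
  set P := D.image (· + 1) with hP
  set A := Λ.powerset.filter fun s => ∃ σ ∈ E,
    (∀ x : Site 2, x ∉ P → σ x = boxFill Λ ξ s x) ∧ ∀ g ∈ D, ¬ IsOddFace σ g with hA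
  set B := Λ.powerset.filter fun s => boxFill Λ ξ s ∈ E ∧ ∀ f ∈ D, ¬ IsOddFace (boxFill Λ ξ s) f with hB
  have hPΛ : P ⊆ Λ := image_add_one_subset hD
  -- double counting of the relation "`boxFill Λ ξ s₀` agrees with `boxFill Λ ξ s` off `P`"
  have key := Finset.card_mul_eq_card_mul (s := A) (t := B) (m := 1) (n := 2 ^ D.card)
    (fun s s₀ => ∀ x : Site 2, x ∉ P → boxFill Λ ξ s₀ x = boxFill Λ ξ s x) ?_ ?_
  · rw [mul_one] at key
    rw [key, mul_comm]
  · -- every `s ∈ A` is related to exactly one `s₀ ∈ B`: the black set of its (unique) completion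
    intro s hs
    rw [hA, Finset.mem_filter, Finset.mem_powerset] at hs
    obtain ⟨-, σ, hσE, hagree, heven⟩ := hs
    have hσξ : ∀ x ∉ Λ, σ x = ξ x := fun x hx => by
      rw [hagree x fun h => hx (hPΛ h), boxFill_apply_of_not_mem ξ _ hx]
    have hσ : σ = boxFill Λ ξ (Λ.filter fun x => σ x = true) := eq_boxFill_of_eqOn hσξ
    rw [Finset.card_eq_one]
    refine ⟨Λ.filter fun x => σ x = true, Finset.eq_singleton_iff_unique_mem.2 ⟨?_, fun s₀ hs₀ => ?_⟩⟩
    · rw [Finset.mem_bipartiteAbove, hB, Finset.mem_filter, Finset.mem_powerset, ← hσ]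
      exact ⟨⟨Finset.filter_subset _ _, hσE, heven⟩, hagree⟩
    · rw [Finset.mem_bipartiteAbove, hB, Finset.mem_filter, Finset.mem_powerset] at hs₀
      obtain ⟨⟨hs₀Λ, -, heven₀⟩, hagree₀⟩ := hs₀
      have h : boxFill Λ ξ s₀ = σ :=
        eq_of_agree_of_even (fun x hx => (hagree₀ x hx).trans (hagree x hx).symm) heven₀ heven
      rw [hσ] at h
      exact boxFill_injOn Λ ξ (Finset.mem_coe.2 (Finset.mem_powerset.2 hs₀Λ))
        (Finset.mem_coe.2 (Finset.mem_powerset.2 (Finset.filter_subset _ _))) h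
  · -- every `s₀ ∈ B` is related to the `2 ^ |D|` sets `s ⊆ Λ` with `s \ P = s₀ \ P`, all in `A`
    intro s₀ hs₀
    rw [hB, Finset.mem_filter, Finset.mem_powerset] at hs₀
    obtain ⟨hs₀Λ, hE₀, heven₀⟩ := hs₀
    have h : A.bipartiteBelow (fun s s₀ => ∀ x : Site 2, x ∉ P → boxFill Λ ξ s₀ x = boxFill Λ ξ s x) s₀ =
        Λ.powerset.filter fun s => ∀ x : Site 2, x ∉ P → boxFill Λ ξ s₀ x = boxFill Λ ξ s x := by
      ext s
      rw [Finset.mem_bipartiteBelow, hA, Finset.mem_filter, Finset.mem_filter, Finset.mem_powerset]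
      exact ⟨fun ⟨⟨hs, _⟩, ha⟩ => ⟨hs, ha⟩, fun ⟨hs, ha⟩ => ⟨⟨hs, boxFill Λ ξ s₀, hE₀, ha, heven₀⟩, ha⟩⟩
    rw [h, card_filter_agree ξ hPΛ hs₀Λ, hP, card_image_add_one]

/-! ## The measure computation -/

/-- At `t = 0` the total `E`-weight of the fillings is the number of `D`-even fillings lying in `E`. -/
theorem sum_indicator_cornerWeight_zero (D Λ : Finset (Site 2)) (ξ : Site 2 → Bool)
    (E : Set (Site 2 → Bool)) :
    ∑ s ∈ Λ.powerset, E.indicator (cornerWeight 0 D) (boxFill Λ ξ s) =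
      ((Λ.powerset.filter fun s =>
          boxFill Λ ξ s ∈ E ∧ ∀ f ∈ D, ¬ IsOddFace (boxFill Λ ξ s) f).card : ℝ≥0∞) := by
  rw [← Finset.sum_boole]
  refine Finset.sum_congr rfl fun s _ => ?_
  rw [Set.indicator_apply, cornerWeight_zero_eq_ite, ite_and]

/-- `(2 ^ l)⁻¹ · 2 ^ d = (2 ^ (l - d))⁻¹` in `ℝ≥0∞` for `d ≤ l`. -/
theorem inv_two_pow_mul {d l : ℕ} (hle : d ≤ l) (N : ℝ≥0∞) :
    ((2 : ℝ≥0∞) ^ l)⁻¹ * (2 ^ d * N) = ((2 : ℝ≥0∞) ^ (l - d))⁻¹ * N := by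
  have h0 : (2 : ℝ≥0∞) ^ d ≠ 0 := pow_ne_zero _ two_ne_zero
  have htop : (2 : ℝ≥0∞) ^ d ≠ ∞ := ENNReal.pow_ne_top ENNReal.ofNat_ne_top
  calc ((2 : ℝ≥0∞) ^ l)⁻¹ * (2 ^ d * N)
      = ((2 : ℝ≥0∞) ^ (l - d) * 2 ^ d)⁻¹ * (2 ^ d * N) := by rw [← pow_add, Nat.sub_add_cancel hle]
    _ = ((2 : ℝ≥0∞) ^ (l - d))⁻¹ * ((2 ^ d)⁻¹ * 2 ^ d) * N := by
        rw [ENNReal.mul_inv (Or.inr htop) (Or.inr h0)]; ring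
    _ = ((2 : ℝ≥0∞) ^ (l - d))⁻¹ * N := by rw [ENNReal.inv_mul_cancel h0 htop, mul_one]

end EvenLawStub

/-- **Stub `stub_evenLawApply`** (programme (R) helper: the pivot coupling, measure form).  For a defect set
`D ⊆ innerVertices Λ`, the `t = 0` corner Gibbs measure (uniform on the `D`-even fillings of `Λ` with
boundary condition `ξ`) is the image of the uniform measure on all `2 ^ |Λ|` fillings under the pivot
completion of `stub_pivotSolve`: the mass of `E` is `2 ^ {-|Λ|}` times the number of black sets `s ⊆ Λ`
whose `D`-even completion off the pivot set `D.image (· + 1)` lies in `E` (the completion map is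
`2 ^ |D|`-to-one onto the `D`-even fillings, and there are `2 ^ (|Λ| - |D|)` of those by the rank lemma). -/
theorem stub_evenLawApply : ∀ (D Λ : Finset (Site 2)), D ⊆ innerVertices Λ → ∀ (ξ : Site 2 → Bool) (E : Set (Site 2 → Bool)), MeasurableSet E → cornerGibbsMeasure 0 D Λ ξ E = ((2 : ENNReal) ^ Λ.card)⁻¹ * ((Λ.powerset.filter fun s => ∃ σ ∈ E, (∀ x : Site 2, x ∉ D.image (· + 1) → σ x = boxFill Λ ξ s x) ∧ ∀ g ∈ D, ¬ IsOddFace σ g).card : ENNReal) := by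
  intro D Λ hD ξ E _
  rw [EvenLawStub.card_filter_exists_completion hD ξ E, cornerGibbsMeasure_apply,
    cornerPartitionFunction_zero_eq_two_pow hD ξ, EvenLawStub.sum_indicator_cornerWeight_zero D Λ ξ E,
    Nat.cast_mul, Nat.cast_pow, Nat.cast_ofNat,
    EvenLawStub.inv_two_pow_mul (Finset.card_le_card (hD.trans (innerVertices_subset Λ)))]

end Summit.CriticalPhenomena.CardyFormulaZ2.Cruxes.IKMixedBoxCrossing.DefectClosureExploration
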